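import Literature.Topology.FourManifolds.ToricBlowupNeck
import Literature.Topology.FourManifolds.GluckTwistExistence
import HarnessLib

/-!
# The glued manifold `(S⁴ ∖ ν(S² × D²)) ∪_τ Ṽ` of the dissolution of a Gluck twist

Given a 2-knot `K : S² ↪ S⁴` with a tubular neighbourhood `ν : S² × ℝ² ↪ S⁴`, we glue the open
subset `A = S⁴ ∖ ν(S² × B̄(0, 1))` of the knot complement to the toric model `Ṽ` of
`Bl_p(S² × ℝ²)` (`ToricBlowupModel.lean` and its sequels) along the end `S² × {‖w‖ > 1}`:
the point `ν (rot_{w/‖w‖} x, w)` of `A` is identified with `toModel (x, w) ∈ Ṽ` — Gluck's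
twist `τ` (the tree's `Literature.Topology.FourManifolds.gluckMap`) on the side of the knot complement, exactly as in the
Gluck twist itself (`GluckTwistExistence.lean`), and the blow-up inclusion on the side of `Ṽ`.

* `TwoKnot.TubularNbhd.dissolveA ν` — the open piece `A` (an open subset of the knot
  complement); `dissolveGlue ν` — the gluing partial diffeomorphism `A ⇀ Ṽ`;
  `dissolveData ν`, **`Dissolve ν`** — the gluing datum and the glued smooth 4-manifold
  `M = A ∪ Ṽ`, Hausdorff (`isClosed_dissolveGraph`), compact (`compactSpace_dissolve`) and
  second countable; `dissolve_inl_eq_inr_iff` — its gluing relation.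

In the next file `M` is shown to be simultaneously a connected sum `Σ_K # ℂℙ²` (through the
involution `Ψ` of `Ṽ`, it is the Gluck twist glued to `(S² × ℝ²) # ℂℙ²`) and a connected sum
`S⁴ # ℂℙ²`, which is the dissolution `Σ_K # ℂℙ² ≅ S⁴ # ℂℙ²` of Gluck twists
(Gompf–Stipsicz, *4-Manifolds and Kirby Calculus*, Ex. 5.2.7(b); Akbulut–Yasui, *Gluck twisting
4-manifolds with odd intersection form* (2013), Cor. 1.3) in the relational language of the tree.
-/

noncomputable section

open scoped Manifold ContDiff Topology
open Set Function Metric Module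
open _root_.Topology

namespace Literature.Topology.FourManifolds

/-- Local notation: `𝔼 n` is the model Euclidean space `EuclideanSpace ℝ (Fin n)`. -/
local notation "𝔼 " n:arg => EuclideanSpace ℝ (Fin n)

/-- Local notation: `𝕊 n` is the unit sphere in `EuclideanSpace ℝ (Fin (n + 1))`. -/
local notation "𝕊 " n:arg => (Metric.sphere (0 : EuclideanSpace ℝ (Fin (n + 1))) 1)

open ToricBlowup SphereCoord

namespace TwoKnot.TubularNbhd

variable {K : TwoKnot} (ν : TwoKnot.TubularNbhd K)

/-! ### The open piece `A = S⁴ ∖ ν(S² × B̄(0,1))` -/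

/-- The closed tube `ν (S² × B̄(0, r))` is closed in `S⁴` (image of a compact set). [folklore] -/
theorem isClosed_image_closedBall (r : ℝ) : IsClosed (ν.toFun '' (univ ×ˢ closedBall (0 : 𝔼 2) r)) :=
  ((isCompact_univ.prod (isCompact_closedBall 0 r)).image ν.continuous).isClosed

/-- **The open piece** `A = S⁴ ∖ ν (S² × B̄(0, 1))`, as an open subset of the knot complement
`S⁴ ∖ K(S²)`. [folklore] -/
def dissolveA : TopologicalSpace.Opens K.complement :=
  ⟨{a | (a : 𝕊 4) ∉ ν.toFun '' (univ ×ˢ closedBall (0 : 𝔼 2) 1)},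
    (ν.isClosed_image_closedBall 1).isOpen_compl.preimage continuous_subtype_val⟩

/-- Membership in the open piece. [folklore] -/
theorem mem_dissolveA_iff (a : K.complement) :
    a ∈ ν.dissolveA ↔ (a : 𝕊 4) ∉ ν.toFun '' (univ ×ˢ closedBall (0 : 𝔼 2) 1) := Iff.rfl

/-- A point `ν b` of the tube lies in (the image of) the open piece iff `‖b.2‖ > 1`. [folklore] -/
theorem apply_not_mem_image_closedBall_iff (b : (𝕊 2) × 𝔼 2) :
    ν.toFun b ∉ ν.toFun '' (univ ×ˢ closedBall (0 : 𝔼 2) 1) ↔ 1 < ‖b.2‖ := by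
  constructor
  · intro h
    by_contra hle
    push Not at hle
    exact h ⟨b, ⟨mem_univ _, by simpa using hle⟩, rfl⟩
  · rintro h ⟨b', ⟨-, hb'⟩, hbb'⟩
    rw [ν.injective hbb'] at hb'
    exact not_le.2 h (by simpa using hb')

/-- The end `‖w‖ > 1` maps into the knot complement. [folklore] -/
theorem apply_mem_complement_of_one_lt {b : (𝕊 2) × 𝔼 2} (hb : 1 < ‖b.2‖) : ν.toFun b ∈ K.complement := by
  rw [SphereEmbedding.mem_complement_iff]
  exact ν.apply_mem_compl_range b.1 (by rintro h; rw [h, norm_zero] at hb; norm_num at hb)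

/-- The point of the open piece given by a point `ν b` of the end, `‖b.2‖ > 1`. [folklore] -/
def endPt {b : (𝕊 2) × 𝔼 2} (hb : 1 < ‖b.2‖) : ν.dissolveA :=
  ⟨⟨ν.toFun b, ν.apply_mem_complement_of_one_lt hb⟩, (ν.apply_not_mem_image_closedBall_iff b).2 hb⟩

/-- The underlying point of `endPt`. [folklore] -/
@[simp] theorem coe_coe_endPt {b : (𝕊 2) × 𝔼 2} (hb : 1 < ‖b.2‖) :
    ((ν.endPt hb : K.complement) : 𝕊 4) = ν.toFun b := rfl

/-- A fixed vector of norm `2` in the plane. [folklore] -/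
def twoVec : 𝔼 2 := EuclideanSpace.single 0 2

/-- `‖twoVec‖ = 2`. [folklore] -/
@[simp] theorem norm_twoVec : ‖twoVec‖ = 2 := by
  rw [twoVec, PiLp.norm_single]; norm_num

/-- The open piece is nonempty: it contains `ν (N, 2 e₀)`. [folklore] -/
instance nonempty_dissolveA : Nonempty ν.dissolveA :=
  ⟨ν.endPt (b := (northPole, twoVec)) (by rw [norm_twoVec]; norm_num)⟩

/-! ### The gluing partial diffeomorphism -/

/-- The end `{(x, w) | ‖w‖ > 1}` of `B = S² × ℝ²`. [folklore] -/
def endB : Set ((𝕊 2) × 𝔼 2) := {b | 1 < ‖b.2‖}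

/-- The end is open. [folklore] -/
theorem isOpen_endB : IsOpen endB := isOpen_lt continuous_const (continuous_norm.comp continuous_snd)

/-- The blown-up point is not in the end. [folklore] -/
theorem basePt_not_mem_endB : ToricBlowup.basePt ∉ endB := by
  change ¬ (1 < ‖(ToricBlowup.basePt.2 : 𝔼 2)‖)
  simp [ToricBlowup.basePt]

/-- Points of the end are off the central fibre. [folklore] -/
theorem snd_ne_zero_of_mem_endB {b : (𝕊 2) × 𝔼 2} (hb : b ∈ endB) : b.2 ≠ 0 := by
  rintro h; change 1 < ‖b.2‖ at hb; rw [h, norm_zero] at hb; norm_num at hb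

/-- The Gluck map and its inverse preserve the end. [folklore] -/
theorem gluckMapInv_mem_endB {b : (𝕊 2) × 𝔼 2} (hb : b ∈ endB) : gluckMapInv b ∈ endB := by
  change 1 < ‖(gluckMapInv b).2‖; rw [gluckMapInv_snd]; exact hb

/-- The Gluck map preserves the end. [folklore] -/
theorem gluckMap_mem_endB {b : (𝕊 2) × 𝔼 2} (hb : b ∈ endB) : gluckMap b ∈ endB := by
  change 1 < ‖(gluckMap b).2‖; rw [gluckMap_snd]; exact hb

/-- The backward gluing map `Ṽ → A` (junk off the image of the end): the blow-down followed by
Gluck's map and `ν`. [folklore] -/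
def dissolveBwd (v : Model) : ν.dissolveA :=
  open scoped Classical in
  if h : blowDown v ∈ endB then ν.endPt (b := gluckMap (blowDown v)) (gluckMap_mem_endB h)
  else Classical.choice inferInstance

/-- The backward map on the relevant region. [folklore] -/
theorem coe_dissolveBwd {v : Model} (h : blowDown v ∈ endB) :
    ((ν.dissolveBwd v : K.complement) : 𝕊 4) = ν.toFun (gluckMap (blowDown v)) := by
  rw [dissolveBwd, dif_pos h]; rfl

/-- **The gluing partial diffeomorphism** `A ⇀ Ṽ` of the dissolution: `ν b ↦ toModel (τ⁻¹ b)` on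
the image of the end, with inverse `v ↦ ν (τ (blowDown v))` on `toModel` of the end. [folklore] -/
def dissolveGlue : OpenPartialHomeomorph ν.dissolveA Model where
  toFun a := toModel (ν.fwd a)
  invFun := ν.dissolveBwd
  source := {a | ((a : K.complement) : 𝕊 4) ∈ ν.toFun '' endB}
  target := toModel '' endB
  map_source' := by
    rintro a ⟨b, hb, hab⟩
    refine ⟨gluckMapInv b, gluckMapInv_mem_endB hb, ?_⟩
    rw [← hab, ν.fwd_apply]
  map_target' := by
    rintro v ⟨b, hb, rfl⟩
    have hbp : b ≠ ToricBlowup.basePt := fun h => basePt_not_mem_endB (h ▸ hb)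
    have h1 : blowDown (toModel b) ∈ endB := by rw [blowDown_toModel hbp]; exact hb
    change ((ν.dissolveBwd (toModel b) : K.complement) : 𝕊 4) ∈ ν.toFun '' endB
    rw [ν.coe_dissolveBwd h1, blowDown_toModel hbp]
    exact ⟨_, gluckMap_mem_endB hb, rfl⟩
  left_inv' := by
    rintro a ⟨b, hb, hab⟩
    have hbp : gluckMapInv b ≠ ToricBlowup.basePt := fun h => basePt_not_mem_endB (h ▸ gluckMapInv_mem_endB hb)
    have hfwd : ν.fwd a = gluckMapInv b := by rw [← hab, ν.fwd_apply]
    have h1 : blowDown (toModel (ν.fwd a)) ∈ endB := by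
      rw [hfwd, blowDown_toModel hbp]; exact gluckMapInv_mem_endB hb
    apply Subtype.ext; apply Subtype.ext
    rw [ν.coe_dissolveBwd h1, hfwd, blowDown_toModel hbp, gluckMap_gluckMapInv (snd_ne_zero_of_mem_endB hb),
      hab]
  right_inv' := by
    rintro v ⟨b, hb, rfl⟩
    have hbp : b ≠ ToricBlowup.basePt := fun h => basePt_not_mem_endB (h ▸ hb)
    have h1 : blowDown (toModel b) ∈ endB := by rw [blowDown_toModel hbp]; exact hb
    change toModel (ν.fwd _) = toModel b
    congr 1
    have : ((ν.dissolveBwd (toModel b) : K.complement) : 𝕊 4) = ν.toFun (gluckMap b) := by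
      rw [ν.coe_dissolveBwd h1, blowDown_toModel hbp]
    change gluckMapInv (ν.toHomeo.symm ((ν.dissolveBwd (toModel b) : K.complement) : 𝕊 4)) = b
    rw [this, ν.toHomeo_symm_apply, gluckMapInv_gluckMap (snd_ne_zero_of_mem_endB hb)]
  open_source := (ν.isOpenEmbedding.isOpenMap _ isOpen_endB).preimage
    (continuous_subtype_val.comp continuous_subtype_val)
  open_target := isOpen_image_toModel isOpen_endB basePt_not_mem_endB
  continuousOn_toFun := by
    refine (continuousOn_toModel.comp ((ν.contMDiffOn_fwd.continuousOn).comp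
      (continuous_subtype_val.comp continuous_subtype_val).continuousOn ?_) ?_)
    · rintro a ⟨b, hb, hab⟩
      change ((a : K.complement) : 𝕊 4) ∈ ν.puncturedTube
      rw [← hab, ν.apply_mem_puncturedTube_iff]
      exact snd_ne_zero_of_mem_endB hb
    · rintro a ⟨b, hb, hab⟩
      change ν.fwd _ ≠ ToricBlowup.basePt
      rw [show ν.fwd ((a : K.complement) : 𝕊 4) = gluckMapInv b by rw [← hab, ν.fwd_apply]]
      exact fun h => basePt_not_mem_endB (h ▸ gluckMapInv_mem_endB hb)
  continuousOn_invFun := by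
    rintro v ⟨b, hb, rfl⟩
    have hbp : b ≠ ToricBlowup.basePt := fun h => basePt_not_mem_endB (h ▸ hb)
    -- near `toModel b`, the backward map is `ν ∘ gluckMap ∘ blowDown` into the double subtype
    have ho : IsOpen (blowDown ⁻¹' endB) := isOpen_endB.preimage continuous_blowDown
    have hmem : toModel b ∈ blowDown ⁻¹' endB := by
      change blowDown (toModel b) ∈ endB; rw [blowDown_toModel hbp]; exact hb
    refine ContinuousAt.continuousWithinAt ?_
    rw [IsInducing.subtypeVal.continuousAt_iff, IsInducing.subtypeVal.continuousAt_iff]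
    have hev : (Subtype.val ∘ Subtype.val ∘ ν.dissolveBwd) =ᶠ[𝓝 (toModel b)]
        fun v => ν.toFun (gluckMap (blowDown v)) := by
      filter_upwards [ho.mem_nhds hmem] with v hv
      exact ν.coe_dissolveBwd hv
    refine (ContinuousAt.congr ?_ hev.symm)
    have hg : ContinuousAt gluckMap (blowDown (toModel b)) :=
      continuousOn_gluckMap.continuousAt ((isOpen_ne.preimage continuous_snd).mem_nhds
        (by rw [blowDown_toModel hbp]; exact snd_ne_zero_of_mem_endB hb))
    have hgb : ContinuousAt (fun v => gluckMap (blowDown v)) (toModel b) :=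
      ContinuousAt.comp (f := blowDown) (g := gluckMap) hg continuous_blowDown.continuousAt
    exact ν.continuous.continuousAt.comp hgb

/-- The source of the gluing map. [folklore] -/
theorem dissolveGlue_source :
    ν.dissolveGlue.source = {a : ν.dissolveA | ((a : K.complement) : 𝕊 4) ∈ ν.toFun '' endB} := rfl

/-- The target of the gluing map. [folklore] -/
theorem dissolveGlue_target : ν.dissolveGlue.target = toModel '' endB := rfl

/-- The gluing map is `toModel ∘ gluckMapInv ∘ ν⁻¹`. [folklore] -/
theorem dissolveGlue_apply (a : ν.dissolveA) : ν.dissolveGlue a = toModel (ν.fwd a) := rfl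

/-- **The gluing map is smooth on its source.** [folklore] -/
theorem contMDiffOn_dissolveGlue : ContMDiffOn (𝓡 4) 𝓘(ℝ, ℂ × ℂ) ∞ ν.dissolveGlue ν.dissolveGlue.source := by
  have hval : ContMDiff (𝓡 4) (𝓡 4) ∞ (fun a : ν.dissolveA => ((a : K.complement) : 𝕊 4)) :=
    contMDiff_subtype_val.comp contMDiff_subtype_val
  refine contMDiffOn_toModel.comp ((ν.contMDiffOn_fwd).comp hval.contMDiffOn ?_) ?_
  · rintro a ⟨b, hb, hab⟩
    change ((a : K.complement) : 𝕊 4) ∈ ν.puncturedTube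
    rw [← hab, ν.apply_mem_puncturedTube_iff]
    exact snd_ne_zero_of_mem_endB hb
  · rintro a ⟨b, hb, hab⟩
    change ν.fwd _ ≠ ToricBlowup.basePt
    rw [show ν.fwd ((a : K.complement) : 𝕊 4) = gluckMapInv b by rw [← hab, ν.fwd_apply]]
    exact fun h => basePt_not_mem_endB (h ▸ gluckMapInv_mem_endB hb)

/-- **The inverse gluing map is smooth on the target.** [folklore] -/
theorem contMDiffOn_dissolveGlue_symm :
    ContMDiffOn 𝓘(ℝ, ℂ × ℂ) (𝓡 4) ∞ ν.dissolveGlue.symm ν.dissolveGlue.target := by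
  rintro v ⟨b, hb, rfl⟩
  have hbp : b ≠ ToricBlowup.basePt := fun h => basePt_not_mem_endB (h ▸ hb)
  have ho : IsOpen (blowDown ⁻¹' endB) := isOpen_endB.preimage continuous_blowDown
  have hmem : toModel b ∈ blowDown ⁻¹' endB := by
    change blowDown (toModel b) ∈ endB; rw [blowDown_toModel hbp]; exact hb
  refine ContMDiffAt.contMDiffWithinAt ?_
  change ContMDiffAt 𝓘(ℝ, ℂ × ℂ) (𝓡 4) ∞ ν.dissolveBwd (toModel b)
  rw [← ContMDiffAt.subtypeVal_comp_iff, ← ContMDiffAt.subtypeVal_comp_iff]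
  have hev : (Subtype.val ∘ Subtype.val ∘ ν.dissolveBwd) =ᶠ[𝓝 (toModel b)]
      fun v => ν.toFun (gluckMap (blowDown v)) := by
    filter_upwards [ho.mem_nhds hmem] with v hv
    exact ν.coe_dissolveBwd hv
  refine ContMDiffAt.congr_of_eventuallyEq ?_ hev
  have hg : ContMDiffAt ((𝓡 2).prod 𝓘(ℝ, 𝔼 2)) ((𝓡 2).prod 𝓘(ℝ, 𝔼 2)) ∞ gluckMap (blowDown (toModel b)) :=
    contMDiffOn_gluckMap_holds.contMDiffAt ((isOpen_ne.preimage continuous_snd).mem_nhds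
      (by rw [blowDown_toModel hbp]; exact snd_ne_zero_of_mem_endB hb))
  exact ν.contMDiff.contMDiffAt.comp _ (hg.comp _ contMDiff_blowDown.contMDiffAt)

/-- The identification `ℂ × ℂ ≃L ℝ⁴` of the model vector spaces (equal dimension). [folklore] -/
def linC2 : (ℂ × ℂ) ≃L[ℝ] 𝔼 4 :=
  ContinuousLinearEquiv.ofFinrankEq (by simp)

/-- **The gluing datum of the dissolution** (`SmoothGlueData` of the open piece and the toric
model). [folklore] -/
def dissolveData : SmoothGlueData (𝓡 4) 𝓘(ℝ, ℂ × ℂ) ν.dissolveA Model (𝔼 4) where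
  glue := ν.dissolveGlue
  contMDiffOn_glue := ν.contMDiffOn_dissolveGlue
  contMDiffOn_glue_symm := ν.contMDiffOn_dissolveGlue_symm
  linA := ContinuousLinearEquiv.refl ℝ (𝔼 4)
  linB := linC2

/-- The gluing map of the datum. [folklore] -/
@[simp] theorem dissolveData_glue : ν.dissolveData.glue = ν.dissolveGlue := rfl

/-- **The gluing relation of the dissolution**: `a ∼ v` iff `v = toModel b` and `a = ν (τ b)` for
a point `b` of the end. [folklore] -/
theorem dissolveRel_iff (a : ν.dissolveA) (v : Model) :
    (a ∈ ν.dissolveData.glue.source ∧ ν.dissolveData.glue a = v) ↔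
      ∃ b ∈ endB, v = toModel b ∧ ((a : K.complement) : 𝕊 4) = ν.toFun (gluckMap b) := by
  constructor
  · rintro ⟨⟨b, hb, hab⟩, rfl⟩
    refine ⟨gluckMapInv b, gluckMapInv_mem_endB hb, ?_, ?_⟩
    · change toModel (ν.fwd _) = _
      rw [show ν.fwd ((a : K.complement) : 𝕊 4) = gluckMapInv b by rw [← hab, ν.fwd_apply]]
    · rw [gluckMap_gluckMapInv (snd_ne_zero_of_mem_endB hb), hab]
  · rintro ⟨b, hb, rfl, hab⟩
    refine ⟨⟨gluckMap b, gluckMap_mem_endB hb, hab.symm⟩, ?_⟩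
    change toModel (ν.fwd _) = toModel b
    rw [hab, ν.fwd_apply, gluckMapInv_gluckMap (snd_ne_zero_of_mem_endB hb)]

/-! ### The glued manifold -/

/-- **The glued manifold of the dissolution** `M = (S⁴ ∖ ν(S² × B̄(0,1))) ∪_τ Ṽ`, a smooth
4-manifold charted on `ℝ⁴`. [folklore] -/
abbrev Dissolve : Type := ν.dissolveData.Glued

/-- **The graph of the gluing map is closed**: within `A × Ṽ` it is the set of `(a, v)` with
`a = ν (τ (blowDown v))` and `‖(blowDown v).2‖ ≥ 1` (the boundary value `1` does not occur in
`A`), the trace of a closed condition on the closed set where `τ ∘ blowDown` is continuous.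
[folklore] -/
theorem isClosed_dissolveGraph : IsClosed {q : ν.dissolveA × Model |
    q.1 ∈ ν.dissolveData.glue.source ∧ ν.dissolveData.glue q.1 = q.2} := by
  -- rewrite the graph
  have hgraph : {q : ν.dissolveA × Model | q.1 ∈ ν.dissolveData.glue.source ∧ ν.dissolveData.glue q.1 = q.2}
      = {q | 1 ≤ ‖(blowDown q.2).2‖} ∩ {q | ((q.1 : K.complement) : 𝕊 4) = ν.toFun (gluckMap (blowDown q.2))} := by
    ext ⟨a, v⟩
    rw [mem_setOf_eq, dissolveRel_iff]
    constructor
    · rintro ⟨b, hb, rfl, hab⟩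
      have hbp : b ≠ ToricBlowup.basePt := fun h => basePt_not_mem_endB (h ▸ hb)
      refine ⟨?_, ?_⟩
      · change 1 ≤ ‖(blowDown (toModel b)).2‖
        rw [blowDown_toModel hbp]; exact le_of_lt hb
      · change ((a : K.complement) : 𝕊 4) = ν.toFun (gluckMap (blowDown (toModel b)))
        rw [blowDown_toModel hbp]; exact hab
    · rintro ⟨h1, h2⟩
      change 1 ≤ ‖(blowDown v).2‖ at h1
      change ((a : K.complement) : 𝕊 4) = ν.toFun (gluckMap (blowDown v)) at h2
      have hlt : 1 < ‖(blowDown v).2‖ := by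
        have ha := a.2
        rw [mem_dissolveA_iff, h2, apply_not_mem_image_closedBall_iff, gluckMap_snd] at ha
        exact ha
      have hE : v ∉ excep := fun hE => by
        rw [blowDown_of_mem_excep hE] at hlt; exact basePt_not_mem_endB hlt
      exact ⟨blowDown v, hlt, (toModel_blowDown hE).symm, h2⟩
  rw [hgraph]
  have hC : IsClosed {q : ν.dissolveA × Model | 1 ≤ ‖(blowDown q.2).2‖} :=
    isClosed_le continuous_const (continuous_norm.comp (continuous_snd.comp
      (continuous_blowDown.comp continuous_snd)))
  have hcont : ContinuousOn (fun q : ν.dissolveA × Model =>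
      ((((q.1 : K.complement) : 𝕊 4)), ν.toFun (gluckMap (blowDown q.2))))
      {q | 1 ≤ ‖(blowDown q.2).2‖} := by
    refine ((continuous_subtype_val.comp continuous_subtype_val).comp continuous_fst).continuousOn.prodMk ?_
    refine ν.continuous.comp_continuousOn (continuousOn_gluckMap.comp
      (continuous_blowDown.comp continuous_snd).continuousOn fun q hq => ?_)
    change 1 ≤ ‖(blowDown q.2).2‖ at hq
    change (blowDown q.2).2 ≠ 0
    rintro h; rw [h, norm_zero] at hq; norm_num at hq
  have := hcont.preimage_isClosed_of_isClosed hC isClosed_diagonal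
  convert this using 1
  ext q
  simp only [mem_inter_iff, mem_setOf_eq, mem_preimage, mem_diagonal_iff]

/-- The glued manifold is Hausdorff. [folklore] -/
instance t2Space_dissolve : T2Space ν.Dissolve :=
  ν.dissolveData.t2Space_of_isClosed_graph ν.isClosed_dissolveGraph

/-! #### Compactness -/

/-- `‖p.1‖ ≤ ‖fromC2 p‖` (Euclidean norm of `ℝ⁴` versus the modulus of a complex coordinate).
[folklore] -/
theorem norm_fst_le_norm_fromC2 (p : ℂ × ℂ) : ‖p.1‖ ≤ ‖fromC2 p‖ := by
  have h := norm_fromC2_sq p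
  have h1 : ‖p.1‖ ^ 2 = Complex.normSq p.1 := (Complex.normSq_eq_norm_sq _).symm
  nlinarith [norm_nonneg p.1, norm_nonneg (fromC2 p), Complex.normSq_nonneg p.2]

/-- `‖p.2‖ ≤ ‖fromC2 p‖`. [folklore] -/
theorem norm_snd_le_norm_fromC2 (p : ℂ × ℂ) : ‖p.2‖ ≤ ‖fromC2 p‖ := by
  have h := norm_fromC2_sq p
  have h1 : ‖p.2‖ ^ 2 = Complex.normSq p.2 := (Complex.normSq_eq_norm_sq _).symm
  nlinarith [norm_nonneg p.2, norm_nonneg (fromC2 p), Complex.normSq_nonneg p.1]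

/-- The compact piece of `B` used for compactness: `S² × B̄(0, 2)` minus the open disc
`discB (B(0, 1))`. [folklore] -/
def cptB : Set ((𝕊 2) × 𝔼 2) := (univ ×ˢ closedBall (0 : 𝔼 2) 2) ∩ (discB '' ball (0 : 𝔼 4) 1)ᶜ

/-- `cptB` is compact. [folklore] -/
theorem isCompact_cptB : IsCompact cptB :=
  (isCompact_univ.prod (isCompact_closedBall _ _)).inter_right (isOpen_image_discB isOpen_ball).isClosed_compl

/-- `cptB` misses the blown-up point. [folklore] -/
theorem basePt_not_mem_cptB : ToricBlowup.basePt ∉ cptB := fun h => h.2 ⟨0, by simp, discB_zero⟩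

/-- **The compact piece of the model**: `toModel (cptB) ∪ Φ₂ (B̄) ∪ Φ₃ (B̄)` with `B̄` the closed
unit ball of `ℂ × ℂ`. [folklore] -/
def cptV : Set Model :=
  toModel '' cptB ∪ Φ₂ '' closedBall (0 : ℂ × ℂ) 1 ∪ Φ₃ '' closedBall (0 : ℂ × ℂ) 1

/-- `cptV` is compact. [folklore] -/
theorem isCompact_cptV : IsCompact cptV := by
  refine ((isCompact_cptB.image_of_continuousOn (continuousOn_toModel.mono fun b hb h =>
    basePt_not_mem_cptB (h ▸ hb))).union ?_).union ?_
  · exact (isCompact_closedBall _ _).image contMDiff_Φ₂.continuous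
  · exact (isCompact_closedBall _ _).image contMDiff_Φ₃.continuous

/-- **Every point of the model of fibre-norm `≤ 2` lies in `cptV`.** [folklore] -/
theorem mem_cptV {v : Model} (hv : ‖(blowDown v).2‖ ≤ 2) : v ∈ cptV := by
  by_cases hs : v ∈ sFibre
  · -- on the south-pole fibre: `v = toModel (blowDown v)` with `blowDown v ∈ cptB`
    have hE : v ∉ excep := fun h => not_mem_sFibre_of_mem_excep h hs
    refine Or.inl (Or.inl ⟨blowDown v, ⟨⟨mem_univ _, by simpa using hv⟩, ?_⟩, toModel_blowDown hE⟩)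
    rintro ⟨z, -, hz⟩
    exact discB_fst_ne_southPole z (by rw [hz]; exact hs)
  by_cases hr : 1 ≤ bdRad v
  · have hE : v ∉ excep := fun h => by rw [bdRad_of_mem_excep h] at hr; norm_num at hr
    refine Or.inl (Or.inl ⟨blowDown v, ⟨⟨mem_univ _, by simpa using hv⟩, ?_⟩, toModel_blowDown hE⟩)
    rintro ⟨z, hz, hzv⟩
    have : bdRad v = ‖z‖ := by rw [bdRad, ← hzv, discBInv_discB]
    rw [this] at hr
    exact not_lt.2 hr (by simpa using hz)
  · push Not at hr
    rcases (not_mem_sFibre_iff v).1 hs with ⟨⟨u, m⟩, rfl⟩ | ⟨⟨k, w⟩, rfl⟩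
    · rw [bdRad_Φ₂] at hr
      by_cases hm : ‖m‖ ≤ 1
      · refine Or.inl (Or.inr ⟨(u, m), ?_, rfl⟩)
        rw [mem_closedBall_zero_iff, Prod.norm_def, max_le_iff]
        exact ⟨(norm_fst_le_norm_fromC2 (u, u * m)).trans hr.le, hm⟩
      · push Not at hm
        have hm0 : m ≠ 0 := by rintro rfl; norm_num at hm
        refine Or.inr ⟨τ₂₃ (u, m), ?_, (Φ₂_eq_Φ₃ (p := (u, m)) hm0).symm⟩
        rw [mem_closedBall_zero_iff, Prod.norm_def, max_le_iff, τ₂₃]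
        refine ⟨?_, ?_⟩
        · rw [norm_inv]; exact inv_le_one_of_one_le₀ hm.le
        · dsimp only
          rw [mul_comm]
          exact (norm_snd_le_norm_fromC2 (u, u * m)).trans hr.le
    · rw [bdRad_Φ₃] at hr
      by_cases hk : ‖k‖ ≤ 1
      · refine Or.inr ⟨(k, w), ?_, rfl⟩
        rw [mem_closedBall_zero_iff, Prod.norm_def, max_le_iff]
        exact ⟨hk, (norm_snd_le_norm_fromC2 (k * w, w)).trans hr.le⟩
      · push Not at hk
        have hk0 : k ≠ 0 := by rintro rfl; norm_num at hk
        refine Or.inl (Or.inr ⟨τ₃₂ (k, w), ?_, (Φ₃_eq_Φ₂ (q := (k, w)) hk0).symm⟩)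
        rw [mem_closedBall_zero_iff, Prod.norm_def, max_le_iff, τ₃₂]
        refine ⟨(norm_fst_le_norm_fromC2 (k * w, w)).trans hr.le, ?_⟩
        dsimp only
        rw [norm_inv]; exact inv_le_one_of_one_le₀ hk.le

/-- **The compact piece of `A`**: the points outside `ν (S² × B(0, 2))`. [folklore] -/
def cptA : Set ν.dissolveA := {a | ((a : K.complement) : 𝕊 4) ∉ ν.toFun '' (univ ×ˢ ball (0 : 𝔼 2) 2)}

/-- `cptA` is compact: its image in `S⁴` is the closed set `S⁴ ∖ ν (S² × B(0, 2))`. [folklore] -/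
theorem isCompact_cptA : IsCompact ν.cptA := by
  have hemb : IsEmbedding (fun a : ν.dissolveA => ((a : K.complement) : 𝕊 4)) :=
    IsEmbedding.subtypeVal.comp IsEmbedding.subtypeVal
  rw [hemb.isCompact_iff]
  have himage : (fun a : ν.dissolveA => ((a : K.complement) : 𝕊 4)) '' ν.cptA =
      (ν.toFun '' (univ ×ˢ ball (0 : 𝔼 2) 2))ᶜ := by
    ext x
    constructor
    · rintro ⟨a, ha, rfl⟩; exact ha
    · intro hx
      have hxK : x ∈ K.complement := by
        rw [SphereEmbedding.mem_complement_iff]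
        rintro ⟨y, rfl⟩
        exact hx ⟨(y, 0), ⟨mem_univ _, by simp⟩, ν.apply_zero y⟩
      have hxA : (⟨x, hxK⟩ : K.complement) ∈ ν.dissolveA := by
        rw [mem_dissolveA_iff]
        rintro ⟨b, ⟨-, hb⟩, hbx⟩
        exact hx ⟨b, ⟨mem_univ _, by
          simp only [mem_closedBall, dist_zero_right] at hb
          simp only [mem_ball, dist_zero_right]; linarith⟩, hbx⟩
      exact ⟨⟨⟨x, hxK⟩, hxA⟩, hx, rfl⟩
  rw [himage]
  exact ((ν.isOpenEmbedding.isOpenMap _ (isOpen_univ.prod isOpen_ball)).isClosed_compl).isCompact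

/-- **The glued manifold is compact**: it is covered by the images of `cptA` and `cptV`.
[folklore] -/
instance compactSpace_dissolve : CompactSpace ν.Dissolve := by
  refine ν.dissolveData.compactSpace_of_forall_not_mem ν.isCompact_cptA isCompact_cptV ?_ ?_
  · intro a ha
    -- `a = ν b` with `1 < ‖b.2‖ < 2`
    obtain ⟨b, ⟨-, hb2⟩, hab⟩ : ((a : K.complement) : 𝕊 4) ∈ ν.toFun '' (univ ×ˢ ball (0 : 𝔼 2) 2) := by
      by_contra h; exact ha h
    have hb1 : 1 < ‖b.2‖ := by
      have := a.2
      rw [mem_dissolveA_iff, ← hab, apply_not_mem_image_closedBall_iff] at this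
      exact this
    have hsrc : a ∈ ν.dissolveData.glue.source := ⟨b, hb1, hab⟩
    refine ⟨hsrc, mem_cptV ?_⟩
    change ‖(blowDown (toModel (ν.fwd _))).2‖ ≤ 2
    rw [show ν.fwd ((a : K.complement) : 𝕊 4) = gluckMapInv b by rw [← hab, ν.fwd_apply],
      blowDown_toModel (fun h => basePt_not_mem_endB (h ▸ gluckMapInv_mem_endB hb1)), gluckMapInv_snd]
    simp only [mem_ball, dist_zero_right] at hb2
    exact hb2.le
  · intro v hv
    have hv2 : 2 < ‖(blowDown v).2‖ := by
      by_contra h; push Not at h; exact hv (mem_cptV h)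
    have hend : blowDown v ∈ endB := lt_trans (by norm_num) hv2
    have hE : v ∉ excep := fun hE => by
      rw [blowDown_of_mem_excep hE] at hend; exact basePt_not_mem_endB hend
    have htgt : v ∈ ν.dissolveData.glue.target := ⟨blowDown v, hend, toModel_blowDown hE⟩
    refine ⟨htgt, ?_⟩
    change ((ν.dissolveBwd v : K.complement) : 𝕊 4) ∉ ν.toFun '' (univ ×ˢ ball (0 : 𝔼 2) 2)
    rw [ν.coe_dissolveBwd hend]
    rintro ⟨b', ⟨-, hb'⟩, hbb'⟩
    rw [ν.injective hbb', gluckMap_snd] at hb'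
    simp only [mem_ball, dist_zero_right] at hb'
    linarith

/-- The glued manifold is second countable. [folklore] -/
instance secondCountable_dissolve : SecondCountableTopology ν.Dissolve :=
  ν.dissolveData.secondCountableTopology

/-- **The gluing relation of `M`**: `inl a = inr v` iff `v = toModel b` and `a = ν (τ b)` for some
`b` in the end `‖b.2‖ > 1`. [folklore] -/
theorem dissolve_inl_eq_inr_iff (a : ν.dissolveA) (v : Model) :
    ν.dissolveData.inl a = ν.dissolveData.inr v ↔
      ∃ b ∈ endB, v = toModel b ∧ ((a : K.complement) : 𝕊 4) = ν.toFun (gluckMap b) := by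
  rw [ν.dissolveData.inl_eq_inr_iff, dissolveRel_iff]

end TwoKnot.TubularNbhd

end Literature.Topology.FourManifolds
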